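import Summits.CriticalPhenomena.PercolationContinuityZ3.Theorems.Transplant.SkelFrmBChoiceResidC
import Summits.CriticalPhenomena.PercolationContinuityZ3.Theorems.Transplant.SkelFrmBChoiceDepth2
import Summits.CriticalPhenomena.PercolationContinuityZ3.Theorems.Transplant.SkelFrmBChoiceDepthYW
import Summits.CriticalPhenomena.PercolationContinuityZ3.Theorems.Transplant.SkelFrmBChoiceWindow3
import Summits.CriticalPhenomena.PercolationContinuityZ3.Theorems.Transplant.SkelFrmBChoiceRootLanding2
import Summits.CriticalPhenomena.PercolationContinuityZ3.Theorems.Transplant.SkelFrmBChoiceRootRunY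
import Summits.CriticalPhenomena.PercolationContinuityZ3.Theorems.Transplant.SkelFrmBChoiceRootPrefix
import HarnessLib

/-!
# N2 (frames-only node `SamePDropOfSkeletonFrm₁`, OPEN), (R) column — **THE (R) RESIDUAL SLOT FUNCTIONS OF RECORD** for stmt's parametric unions
# `SkelFrmBChoiceResidQV` (`gxQ mk gxR fxR`, `fxQ mk fxR`, `exQ mk exR`, `mxQ mxR`, `PxQ mk PxR`; lead g12 11:03:36Z: each column posts its residual
# FUNCTIONS + floor list, the node tuple takes the union): `NegB.gxR0 mk` ((R-46)(g): `60·(Rs + 1)`), `NegB.fxR mk` (`= KS.fxR0 mk = Rs + R′0 + prB0 + 1`,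
# Bridge0), `NegB.exR0 mk` (the SIX excess floors of the two `_of_le` wrappers `NegB.rootLegAt_frmQ3KV_fst/_snd_of_le`), `NegB.PxR mk := KS.Px0 mk`,
# `NegB.mxR := 0`, with the `rfl`/`max_le_iff` floor lemmas

The six excess floors (`hexRL`, `hexRB`, `hexYb`, `hexZ` of the first axis; `hexRL`, `hexRB`, `hexYb`, `hexP`, `hexY` of the second), at the era-3
windows `qxQ4 / WxYQ4` (SkelFrmBChoiceWindow3) and depths `ZD2` (SkelFrmBChoiceDepth2), `ZDYW` (SkelFrmBChoiceDepthYW), `KS.ZDP` (SkelFrmBChoiceRootPrefix):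
`KS0.r₀0 mk (RLD …) + 1` (`RL … = RLD …` by `RL_eq_RLD`), `KS0.r₀0 mk (KS.RB0 mk) + 1`, `KS.Yb0 mk + 1`, `KS.D0s mk (kgq qxQ4) + ZD2 + 13·⌊sL⌋₊ + 1`
(first-axis depth row via `reachR1_le`), `KS.D0s mk (kgq 0) + ZDP + 1` (prefix depth row via `reachP_le`), `KS.D2R mk WxYQ4 + ZDYW + 13·n_L + 1`
(y′ depth row via `reachRY_le`).  At the tuple each floor is `(exR0_floors (le_exQ …).2.2.2.2).k` (stmt's `le_exQ`, 5th conjunct `exR ≤ exQ`).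
NON-VACUITY (lead g11 standing order): definitions + `rfl`/`max` facts; nothing assumed.
builds on p205010 (kernel theorem, internal audit signed; external expert review pending) — nothing in this file uses p205010; nothing here is a
claim about the open node `SamePDropOfSkeletonFrm₁`.
Lane `prim-bschramm`, seat `prim-bschramm-p3` (gen 18; N2 design owner, (R) column owner); helper file (`--supports stmt-CriticalPhenomena-4575 --as helper`).
[cite: KozmaNitzan2024, §4 p. 28 ((32) at the root)]
-/

noncomputable section

open scoped Classical

namespace Summit.CriticalPhenomena.PercolationContinuityZ3.Theorems.Transplant

namespace PlanarSkeletonFrm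

namespace NegB

open Literature.Probability.Percolation Literature.Probability.LatticeModels SimpleGraph
open SkelConc (Consts)
open Skelφ (kgSL)
open Neg

/-- **The (R) box residual** `gxR0 mk := 60·(Rs mk + 1)` ((R-46)(g): `M_L ≥ g ≥ 60(Rs+1)` ⇒ `sL ≥ 30·Rs + 28`). [this work] -/
def gxR0 (mk : ℕ) : Neg.FSlot := fun _ _ _ _ _ _ _ t _ D => 60 * (KS.Rs t D mk + 1)

/-- **The (R) width residual** `fxR mk := KS.fxR0 mk = Rs + R′0 + prB0 + 1` (Bridge0). [this work] -/
def fxR (mk : ℕ) : Neg.FSlot := fun κ _ _ _ _ _ Φ t p D => KS.fxR0 κ Φ t p D mk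

/-- **The (R) excess residual**: the max of the six excess floors of the two `_of_le` wrappers (see the module docstring). [this work] -/
def exR0 (mk : ℕ) : GSlot := fun κ _ _ _ _ _ Φ t p D g f =>
  max (KS0.r₀0 t D mk (RLD κ Φ t p D g f) + 1) (max (KS0.r₀0 t D mk (KS.RB0 κ Φ t p D mk) + 1) (max (KS.Yb0 κ Φ t p D mk g f + 1)
    (max (KS.D0s κ Φ t p D mk g f (kgq κ Φ t p D g f (qxQ4 κ Φ t p D g f)) + ZD2 κ Φ t p D g f + 13 * (kgSL (nL κ Φ t p D g f) (ℓL κ Φ t p D g f) (hL κ Φ t p D g f)).toNat + 1)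
    (max (KS.D0s κ Φ t p D mk g f (kgq κ Φ t p D g f 0) + KS.ZDP κ Φ t p D g f + 1)
      (KS.D2R κ Φ t p D mk g f (WxYQ4 κ Φ t p D g f) + ZDYW κ Φ t p D g f + 13 * nL κ Φ t p D g f + 1)))))

/-- **The (R) extra-pair slot** `PxR mk := KS.Px0 mk` (the root bridge pair; ChoiceBridge0's `hPx`). [this work] -/
def PxR (mk : ℕ) : PSlot := KS.Px0 mk

/-- **The (R) rim-diameter residual** `mxR := 0` (the (R) rim device reads `mRS … mx` like (C): `hDm_R` holds at every `mx`). [this work] -/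
def mxR : GSlot := fun _ _ _ _ _ _ _ _ _ _ _ _ => 0

section Floors

variable (κ : Consts) {V : Type} [DecidableEq V] [Countable V] {G : SimpleGraph V} [G.LocallyFinite] (Φ : PlanarSkeletonFrm G) (t : V) (p : unitInterval)
  (D : Skelφ.StepI.DataNS V) (mk g f : ℕ)

/-- `gxR0` unfolded. [folklore] -/
theorem gxR0_at : gxR0 mk κ Φ t p D = 60 * (KS.Rs t D mk + 1) := rfl

/-- `fxR` unfolded. [folklore] -/
theorem fxR_at : fxR mk κ Φ t p D = KS.fxR0 κ Φ t p D mk := rfl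

/-- `PxR` unfolded. [folklore] -/
theorem PxR_at : PxR mk κ Φ t p D = KS.Px0 mk κ Φ t p D := rfl

/-- `mxR = 0`. [folklore] -/
theorem mxR_at : mxR κ Φ t p D g f = 0 := rfl

/-- **The six (R) excess floors from `exR0 mk ≤ ex`** (in the order `hexRL`, `hexRB`, `hexYb`, `hexZ`, `hexP`, `hexY`). [folklore] -/
theorem exR0_floors {ex : ℕ} (h : exR0 mk κ Φ t p D g f ≤ ex) :
    KS0.r₀0 t D mk (RLD κ Φ t p D g f) + 1 ≤ ex ∧ KS0.r₀0 t D mk (KS.RB0 κ Φ t p D mk) + 1 ≤ ex ∧ KS.Yb0 κ Φ t p D mk g f + 1 ≤ ex ∧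
    KS.D0s κ Φ t p D mk g f (kgq κ Φ t p D g f (qxQ4 κ Φ t p D g f)) + ZD2 κ Φ t p D g f +
        13 * (kgSL (nL κ Φ t p D g f) (ℓL κ Φ t p D g f) (hL κ Φ t p D g f)).toNat + 1 ≤ ex ∧
    KS.D0s κ Φ t p D mk g f (kgq κ Φ t p D g f 0) + KS.ZDP κ Φ t p D g f + 1 ≤ ex ∧
    KS.D2R κ Φ t p D mk g f (WxYQ4 κ Φ t p D g f) + ZDYW κ Φ t p D g f + 13 * nL κ Φ t p D g f + 1 ≤ ex := by
  unfold exR0 at h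
  simp only [max_le_iff] at h
  obtain ⟨h1, h2, h3, h4, h5, h6⟩ := h
  exact ⟨h1, h2, h3, h4, h5, h6⟩

/-- The six floors hold at `exR0` itself. [folklore] -/
theorem exR0_floors_self :
    KS0.r₀0 t D mk (RLD κ Φ t p D g f) + 1 ≤ exR0 mk κ Φ t p D g f ∧ KS0.r₀0 t D mk (KS.RB0 κ Φ t p D mk) + 1 ≤ exR0 mk κ Φ t p D g f ∧
    KS.Yb0 κ Φ t p D mk g f + 1 ≤ exR0 mk κ Φ t p D g f ∧
    KS.D0s κ Φ t p D mk g f (kgq κ Φ t p D g f (qxQ4 κ Φ t p D g f)) + ZD2 κ Φ t p D g f +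
        13 * (kgSL (nL κ Φ t p D g f) (ℓL κ Φ t p D g f) (hL κ Φ t p D g f)).toNat + 1 ≤ exR0 mk κ Φ t p D g f ∧
    KS.D0s κ Φ t p D mk g f (kgq κ Φ t p D g f 0) + KS.ZDP κ Φ t p D g f + 1 ≤ exR0 mk κ Φ t p D g f ∧
    KS.D2R κ Φ t p D mk g f (WxYQ4 κ Φ t p D g f) + ZDYW κ Φ t p D g f + 13 * nL κ Φ t p D g f + 1 ≤ exR0 mk κ Φ t p D g f :=
  exR0_floors κ Φ t p D mk g f le_rfl

/-- **The box floor at any dominating slot**: `60·(Rs + 1) ≤ gx` from `gxR0 mk ≤ gx` (stmt's `le_gT_gxQ ….2.2`). [folklore] -/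
theorem hgR_of_ge {gx : ℕ} (h : gxR0 mk κ Φ t p D ≤ gx) : 60 * (KS.Rs t D mk + 1) ≤ gx := h

/-- **The width floor at any dominating slot**: `KS.fxR0 mk ≤ fx` from `fxR mk ≤ fx` (stmt's `le_fT_fxQ ….2.2`). [folklore] -/
theorem hf_of_ge {fx : ℕ} (h : fxR mk κ Φ t p D ≤ fx) : KS.fxR0 κ Φ t p D mk ≤ fx := h

end Floors

end NegB

end PlanarSkeletonFrm

end Summit.CriticalPhenomena.PercolationContinuityZ3.Theorems.Transplant

end
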